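import Mathlib
import Literature.MathematicalPhysics.QuantumLattice.ThinSectorFoldDyadic
import HarnessLib

/-!
# Four-sector counting, fold ranges: the FORWARD range total at the √v-weighted (thin) tolerance — `count_anti_total_weighted`

Topic `Literature/MathematicalPhysics/QuantumLattice`; sub-namespace `BandSectorCounting`.  File 3 §3 of the log-free ANISOTROPIC anchored four-sector
counting lemma («E1-P2-THIN-COUNT», cell gate-hubbard-kl, plan g17 (R41); seat p4; plan HOME/prover-p4/E1-P2-THIN-COUNT-PLAN.md §Refinement 2).
`count_anti_total` of the isotropic lemma sums the anti-diagonal fibre counts (`count_anti_sigma`) over the `4N` half-grid values of `σ` at the CONSTANT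
tolerance `C_δ·w`, through `dyadic_total` — whose `(J+1)` becomes the fold-range `N·log N`.  Here each fibre is counted at its OWN tolerance
`δ_s = C₀·w² + C₁·w·√v_s`, `v_s = |h(σ_s, σ_s)|` (`count_anti_sigma` VERBATIM per `σ`; its only size hypothesis `δ ≤ η₀/2` holds for `w` small since
`v_s ≤ V` is bounded), and the widths are summed by `dyadic_total_weighted` (§2):

* **`count_anti_total_weighted`** — `Σ_s #{i : |h(σ_s − t_i/2, σ_s + t_i/2)| ≤ C₀w² + C₁w√v_s ∧ |G| ≤ 2λ} ≤
  (τ/ℓ₅ + 1)·2·((8π·W₁ + dyadic_total-bound(C_δ := C₀w))/w + 4N)` with `W₁ = 2√((C₀ + 2C₁² + C₁√(2C₀))/(h_min/2)) + 2√(2·2A₂)C₁/(h_min/2)`: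
  linear in `N = 2π/w` plus `(J+1)·O(√w)/w = o(N)` — the fold-range `log` is gone (Mastropietro (14.67) p. 223; the printed isotropic `|h|` of p. 229 and
  Rivasseau 2002 Lemma 5's flat-face log are the contrast cases).

The anchor's transversal slack (fat only at the `m = 3` umklapp corner, where the elliptic window is handled by `ThinSectorFoldOneSided`) is NOT in this
file: it enters the Taylor step (file 4).  Everything is PROVED; no definitions, no named facts.

## Sources

* V. Mastropietro, *Non-Perturbative Renormalization* (2008), ch. 14 (14.67) p. 223; p. 229. [Mastropietro2008]
* G. Benfatto, A. Giuliani, V. Mastropietro, Ann. Henri Poincaré 7 (2006) 809–898, Lemma 3.1, App. A2. [BenfattoGiulianiMastropietro2006]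
-/

noncomputable section

open Real Set

namespace Literature.MathematicalPhysics.QuantumLattice.BandSectorCounting

section Assembly

variable {a b : ℝ} (B : BandBounds a b) {μ : ℝ} (hμ : μ ∈ Icc a b)
include B hμ

/-- **The forward (anti-diagonal) range at the √v-weighted tolerance**: for `0 < w ≤ 1`, `N w = 2π`, `2^J w = π`, a bound `V` of the diagonal
values with `C₀w² + C₁w√V ≤ η₀/2`, and the smallness hypotheses of `count_anti_total`:
`Σ_{s<4N} #{i<⌊τ/w⌋ : |h(σ_s − t_i/2, σ_s + t_i/2)| ≤ C₀w² + C₁w√|h(σ_s,σ_s)| ∧ |G(σ_s, t_i)| ≤ 2λ} ≤ (τ/ℓ₅ + 1)·2·((8πW₁ + D(C₀w))/w + 4N)`.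
[cite: Mastropietro2008, ch. 14 (14.67)] -/
theorem count_anti_total_weighted {θ₁ w C₀ C₁ lam τ η₀ η₁ V : ℝ} (hw : 0 < w) (hw1 : w ≤ 1) {N J : ℕ} (hN : (N : ℝ) * w = 2 * π)
    (hJ : (2 : ℝ) ^ J * w = π) (hC₀ : 0 < C₀) (hC₁ : 0 ≤ C₁) (hlam : 0 < lam) (hτ : 0 < τ) (hη₀ : 0 < η₀) (hη₁ : 0 < η₁)
    (hV : ∀ s : ℕ, |hfun μ θ₁ (w / 2 + s * (w / 2)) (w / 2 + s * (w / 2))| ≤ V)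
    (h2δ : C₀ * w ^ 2 + C₁ * w * Real.sqrt V ≤ η₀ / 2) (hlo : a ≤ μ - η₀) (hhi : μ + η₀ ≤ b)
    (heven : 2 * B.A2 * (η₀ / B.Dtmin + B.smax * (B.Cg * (lam + B.A2 * τ + 2 * B.smax * (η₀ / B.Dtmin)) + τ / 2)) ≤ B.hmin / 2)
    (hH : (16 * B.smax ^ 2 + 8 * B.A2) * (η₀ / B.Dtmin + B.smax * (B.Cg * (η₁ / 4 + 2 * B.smax * (η₀ / B.Dtmin)))) ≤ 2 * B.hmin) :
    ∑ s ∈ Finset.range (4 * N), ((((Finset.range ⌊τ / w⌋₊).filter fun i : ℕ =>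
        |hfun μ θ₁ (w / 2 + s * (w / 2) - (w + i * w) / 2) (w / 2 + s * (w / 2) + (w + i * w) / 2)| ≤
            C₀ * w ^ 2 + C₁ * w * Real.sqrt |hfun μ θ₁ (w / 2 + s * (w / 2)) (w / 2 + s * (w / 2))| ∧
        |Gfun μ θ₁ (w / 2 + s * (w / 2)) (w + i * w)| ≤ 2 * lam).card : ℝ)) ≤
      (τ / min (η₀ / (2 * (2 * B.A2) * τ)) (2 * lam / (8 * B.smax ^ 2 + 4 * B.A2)) + 1) * (2 * ((8 * π * (2 * Real.sqrt ((C₀ + 2 * C₁ ^ 2 + C₁ * Real.sqrt (2 * C₀)) / (B.hmin / 2)) + 2 * Real.sqrt (2 * (2 * B.A2)) * C₁ / (B.hmin / 2)) +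
      (((J : ℝ) + 1) * (2 * Real.sqrt (C₀ * w / (B.hmin / 2)) * (2 * (32 * (4 * π / min (η₀ / (2 * (8 * B.smax))) (η₁ / (4 * (16 * B.smax ^ 2 + 8 * B.A2))) + 1) / η₁ + 16 * π / η₀) * (C₀ * w) + (8 * (4 * π / min (η₀ / (2 * (8 * B.smax))) (η₁ / (4 * (16 * B.smax ^ 2 + 8 * B.A2))) + 1) / Real.sqrt (2 * B.hmin)) * Real.sqrt (2 * (C₀ * w)) + (2 * (4 * π / min (η₀ / (2 * (8 * B.smax))) (η₁ / (4 * (16 * B.smax ^ 2 + 8 * B.A2))) + 1))) +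
        (2 * (32 * (4 * π / min (η₀ / (2 * (8 * B.smax))) (η₁ / (4 * (16 * B.smax ^ 2 + 8 * B.A2))) + 1) / η₁ + 16 * π / η₀) * (2 * (C₀ * w) * Real.sqrt (2 * (2 * B.A2)) / (B.hmin / 2)) * Real.sqrt ((C₀ * w) * π) +
          Real.sqrt 2 * (8 * (4 * π / min (η₀ / (2 * (8 * B.smax))) (η₁ / (4 * (16 * B.smax ^ 2 + 8 * B.A2))) + 1) / Real.sqrt (2 * B.hmin)) * (2 * (C₀ * w) * Real.sqrt (2 * (2 * B.A2)) / (B.hmin / 2)) + (2 * (4 * π / min (η₀ / (2 * (8 * B.smax))) (η₁ / (4 * (16 * B.smax ^ 2 + 8 * B.A2))) + 1)) * (2 * (C₀ * w) * Real.sqrt (2 * (2 * B.A2)) / (B.hmin / 2)) / Real.sqrt (C₀ * w)) +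
        8 * π * (2 * (C₀ * w) * Real.sqrt (2 * (2 * B.A2)) / (B.hmin / 2)) / Real.sqrt (2 * (C₀ * w) * π)))) / w + 4 * N)) := by
  have hA := B.A2_pos; have hs := B.smax_pos; have hh := B.hmin_pos
  set Q₄ := 4 * π / min (η₀ / (2 * (8 * B.smax))) (η₁ / (4 * (16 * B.smax ^ 2 + 8 * B.A2))) + 1 with hQ₄
  have hℓ₄ : 0 < min (η₀ / (2 * (8 * B.smax))) (η₁ / (4 * (16 * B.smax ^ 2 + 8 * B.A2))) := lt_min (by positivity) (by positivity)
  have hQ₄0 : 0 < Q₄ := by positivity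
  set X := 32 * Q₄ / η₁ + 16 * π / η₀ with hX
  set Y := 8 * Q₄ / Real.sqrt (2 * B.hmin) with hY
  set Z := 2 * Q₄ with hZ
  have hX0 : 0 ≤ X := by positivity
  have hY0 : 0 ≤ Y := by positivity
  have hZ0 : 0 ≤ Z := by positivity
  set ℓ₅ := min (η₀ / (2 * (2 * B.A2) * τ)) (2 * lam / (8 * B.smax ^ 2 + 4 * B.A2)) with hℓ₅
  have hℓ₅0 : 0 < ℓ₅ := lt_min (by positivity) (by positivity)
  set K₀ := ⌊τ / w⌋₊ with hK₀
  have hK₀τ : (K₀ : ℝ) * w ≤ τ := by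
    have := Nat.floor_le (div_nonneg hτ.le hw.le) (a := τ / w)
    rwa [le_div_iff₀ hw] at this
  -- the diagonal values and the per-σ tolerances
  set v : ℕ → ℝ := fun s => |hfun μ θ₁ (w / 2 + s * (w / 2)) (w / 2 + s * (w / 2))| with hv
  have hv0 : ∀ s, 0 ≤ v s := fun s => abs_nonneg _
  set δσ : ℕ → ℝ := fun s => C₀ * w ^ 2 + C₁ * w * Real.sqrt (v s) with hδσ
  have hδσ0 : ∀ s, 0 ≤ δσ s := fun s => by rw [hδσ]; positivity
  have hδση : ∀ s, δσ s ≤ η₀ / 2 := by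
    intro s
    have : Real.sqrt (v s) ≤ Real.sqrt V := Real.sqrt_le_sqrt (hV s)
    have := mul_le_mul_of_nonneg_left this (by positivity : 0 ≤ C₁ * w)
    rw [hδσ]; linarith
  set bσ : ℕ → ℝ := fun s =>
    if v s ≤ 2 * δσ s then 2 * Real.sqrt (δσ s / (B.hmin / 2))
    else 2 * δσ s * Real.sqrt (2 * (2 * B.A2)) / (B.hmin / 2 * Real.sqrt (v s)) with hbσ
  -- per-fibre bound (count_anti_sigma at δ := δ_s)
  have hper : ∀ s ∈ Finset.range (4 * N), ((((Finset.range K₀).filter fun i : ℕ =>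
        |hfun μ θ₁ (w / 2 + s * (w / 2) - (w + i * w) / 2) (w / 2 + s * (w / 2) + (w + i * w) / 2)| ≤
            C₀ * w ^ 2 + C₁ * w * Real.sqrt |hfun μ θ₁ (w / 2 + s * (w / 2)) (w / 2 + s * (w / 2))| ∧
        |Gfun μ θ₁ (w / 2 + s * (w / 2)) (w + i * w)| ≤ 2 * lam).card : ℝ)) ≤
      (τ / ℓ₅ + 1) * (2 * (bσ s / w + 1)) := by
    intro s _
    have h := count_anti_sigma B hμ (θ₁ := θ₁) (σ := w / 2 + s * (w / 2)) (δ := δσ s) hw (hδσ0 s) hlam hτ hη₀ (hδση s) hlo hhi heven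
    refine h.trans ?_
    have hb0 : 0 ≤ bσ s := by rw [hbσ]; dsimp only; split_ifs <;> positivity
    have hfac : (K₀ : ℝ) * w / ℓ₅ + 1 ≤ τ / ℓ₅ + 1 := by
      have := div_le_div_of_nonneg_right hK₀τ hℓ₅0.le; linarith
    exact mul_le_mul_of_nonneg_right hfac (by positivity)
  -- the weighted dyadic total
  have hT : (((Finset.range (4 * N)).card : ℝ)) ≤ 8 * π / w := by
    rw [Finset.card_range]; push_cast
    rw [le_div_iff₀ hw]; nlinarith
  have hdy := dyadic_total_weighted (Finset.range (4 * N)) v (C₀ := C₀) (C₁ := C₁)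
    hw hw1 hC₀ hC₁ (half_pos hh) (by positivity : (0:ℝ) < 2 * B.A2) hX0 hY0 hZ0 hJ hT hv0
    (fun η hη => count_levels_diag B hμ (θ₁ := θ₁) hw hN hη hη₀ hη₁ hlo hhi hH)
  have hdy' : ∑ s ∈ Finset.range (4 * N), bσ s ≤
      8 * π * (2 * Real.sqrt ((C₀ + 2 * C₁ ^ 2 + C₁ * Real.sqrt (2 * C₀)) / (B.hmin / 2)) + 2 * Real.sqrt (2 * (2 * B.A2)) * C₁ / (B.hmin / 2)) +
      (((J : ℝ) + 1) * (2 * Real.sqrt (C₀ * w / (B.hmin / 2)) * (2 * X * (C₀ * w) + Y * Real.sqrt (2 * (C₀ * w)) + Z) +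
        (2 * X * (2 * (C₀ * w) * Real.sqrt (2 * (2 * B.A2)) / (B.hmin / 2)) * Real.sqrt ((C₀ * w) * π) +
          Real.sqrt 2 * Y * (2 * (C₀ * w) * Real.sqrt (2 * (2 * B.A2)) / (B.hmin / 2)) + Z * (2 * (C₀ * w) * Real.sqrt (2 * (2 * B.A2)) / (B.hmin / 2)) / Real.sqrt (C₀ * w)) +
        8 * π * (2 * (C₀ * w) * Real.sqrt (2 * (2 * B.A2)) / (B.hmin / 2)) / Real.sqrt (2 * (C₀ * w) * π))) := by
    have e : ∀ s, bσ s = (if v s ≤ 2 * (C₀ * w ^ 2 + C₁ * w * Real.sqrt (v s)) then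
        2 * Real.sqrt ((C₀ * w ^ 2 + C₁ * w * Real.sqrt (v s)) / (B.hmin / 2))
        else 2 * (C₀ * w ^ 2 + C₁ * w * Real.sqrt (v s)) * Real.sqrt (2 * (2 * B.A2)) / (B.hmin / 2 * Real.sqrt (v s))) :=
      fun s => by rw [hbσ]
    simp only [e]
    exact hdy
  -- sum the per-fibre bounds
  calc _ ≤ ∑ s ∈ Finset.range (4 * N), (τ / ℓ₅ + 1) * (2 * (bσ s / w + 1)) := Finset.sum_le_sum hper
    _ = (τ / ℓ₅ + 1) * (2 * ((∑ s ∈ Finset.range (4 * N), bσ s) / w + 4 * N)) := by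
        rw [← Finset.mul_sum, ← Finset.mul_sum, Finset.sum_add_distrib, Finset.sum_div, Finset.sum_const,
          Finset.card_range]
        simp
    _ ≤ _ := by
        apply mul_le_mul_of_nonneg_left _ (by positivity)
        apply mul_le_mul_of_nonneg_left _ (by norm_num)
        refine add_le_add (div_le_div_of_nonneg_right (hdy'.trans (le_of_eq ?_)) hw.le) le_rfl
        simp only [hX, hY, hZ, hQ₄]

end Assembly

end Literature.MathematicalPhysics.QuantumLattice.BandSectorCounting

end
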